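import Summits.CriticalPhenomena.CardyFormulaZ2.Theorems.CardyFlipRussoCoveringLegStubLowerInclusion
import Literature.Probability.Percolation.SitePaths
import Literature.Probability.RandomPlanarGeometry.AffineInterp
import HarnessLib

/-!
# Preliminaries for the blocking stub of line `five-arm-null` (skeleton v5): lattice paths as polylines

Crux `Summit.CriticalPhenomena.CardyFormulaZ2.Theses.CardyFlipRusso.CoveringLeg` (stmt-CriticalPhenomena-6435), line
`five-arm-null`, registered stub `stub_blocking_of_planar : Sig.stub_blockingOfPlanar` (lead c5).  This file holds the
lattice-side preliminaries of that stub, all deterministic: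

* `block_pathIn_chain` — a `PathIn` is realised by a finite chain `f : Fin (n+1) → V` of adjacent vertices;
* `block_affineInterp_mem` — every point of the piecewise-affine interpolation `affineInterp L` on `[0, |L| − 1]` is a
  vertex (if `|L| = 1`) or lies on the closed segment between two consecutive points of `L`;
* `block_trace_point` — hence every point of the polyline through the drawn positions `δ·zS (f i)` of a chain lies within one
  mesh edge `δ` of a vertex position, and is a vertex position or a point of a closed edge segment;
* `block_traces_disjoint` — by the planarity of the straight-line drawing of `G_s` (`Sig.stub_gsPlanar`, proved as `stub_gsPlanar` p140252, here a hypothesis), the polylines of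
  two chains with NO common vertex are disjoint (the self-duality input: an open and a closed crude crossing never meet);
* `block_uc` — uniform continuity of a plane homeomorphism on the model box `[-2, 2]²`, and `block_re_im_of_dist` —
  coordinates of nearby points.

References: B. Bollobás, O. Riordan, *Percolation* (2006), Ch. 7 Claim 19 p. 192 (the blocking half of the sandwich)
[BollobasRiordan2006]; V. Beffara, *Is critical 2D percolation universal?* (2008) §5.1 (the lattice `G_s`) [Beffara2008Universal].
-/

noncomputable section

namespace Summit.CriticalPhenomena.CardyFormulaZ2.Cruxes.CoveringLeg.FiveArmNull

open Set Metric
open Literature.Probability.RandomPlanarGeometry Literature.Probability.Percolation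
open Literature.Barriers.CriticalPhenomena (MixedSite)

/-! ### Paths as finite chains -/

/-- **A `PathIn` is a finite chain of adjacent vertices inside the set.** [folklore] -/
theorem block_pathIn_chain {V : Type*} {G : SimpleGraph V} {A : Set V} {u v : V} (h : PathIn G A u v) :
    ∃ (n : ℕ) (f : Fin (n + 1) → V), f 0 = u ∧ f (Fin.last n) = v ∧ (∀ i, f i ∈ A) ∧
      ∀ i : Fin n, G.Adj (f (Fin.castSucc i)) (f (Fin.succ i)) := by
  obtain ⟨hu, h⟩ := h
  induction h with
  | refl => exact ⟨0, fun _ => u, rfl, rfl, fun _ => hu, fun i => i.elim0⟩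
  | @tail b c _ hbc ih =>
    obtain ⟨n, f, hf0, hfl, hfA, hadj⟩ := ih
    refine ⟨n + 1, Fin.snoc f c, ?_, ?_, ?_, ?_⟩
    · have e0 : (0 : Fin (n + 1 + 1)) = Fin.castSucc (0 : Fin (n + 1)) := rfl
      rw [e0, Fin.snoc_castSucc, hf0]
    · exact Fin.snoc_last _ _
    · intro i
      refine Fin.lastCases ?_ (fun j => ?_) i
      · rw [Fin.snoc_last]; exact hbc.2
      · rw [Fin.snoc_castSucc]; exact hfA j
    · intro i
      refine Fin.lastCases ?_ (fun j => ?_) i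
      · rw [Fin.succ_last, Fin.snoc_last, Fin.snoc_castSucc, hfl]
        exact hbc.1
      · rw [Fin.snoc_castSucc, Fin.succ_castSucc, Fin.snoc_castSucc]
        exact hadj j

/-! ### Points of a piecewise-affine interpolation -/

/-- **Every point of `affineInterp L` on `[0, |L| − 1]` is the unique vertex (if `|L| = 1`) or lies on the closed segment of two
consecutive points of `L`.** [folklore] -/
theorem block_affineInterp_mem (L : List ℂ) (hL : L ≠ []) {s : ℝ} (hs0 : 0 ≤ s) (hs1 : s ≤ (L.length : ℝ) - 1) :
    (∃ h : L.length = 1, affineInterp L s = L[0]'(by omega)) ∨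
      ∃ (j : ℕ) (hj : j + 1 < L.length), affineInterp L s ∈ segment ℝ (L[j]'(by omega)) (L[j + 1]'hj) := by
  have hlen : 0 < L.length := List.length_pos_of_ne_nil hL
  by_cases h1 : L.length = 1
  · left
    refine ⟨h1, ?_⟩
    obtain ⟨a, L', rfl⟩ := List.exists_cons_of_length_pos hlen
    have : L' = [] := by simpa using h1
    subst this
    rfl
  · right
    have h2 : 2 ≤ L.length := by omega
    -- the index `j = min ⌊s⌋₊ (|L| - 2)`
    set j : ℕ := min ⌊s⌋₊ (L.length - 2) with hjdef
    have hj : j + 1 < L.length := by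
      have : j ≤ L.length - 2 := min_le_right _ _
      omega
    have hsj : (j : ℝ) ≤ s := by
      have a1 : (j : ℝ) ≤ (⌊s⌋₊ : ℝ) := by exact_mod_cast min_le_left _ _
      exact a1.trans (Nat.floor_le hs0)
    have hsj1 : s ≤ (j : ℝ) + 1 := by
      rcases le_or_gt ⌊s⌋₊ (L.length - 2) with hle | hgt
      · have : j = ⌊s⌋₊ := min_eq_left hle
        rw [this]
        exact (Nat.lt_floor_add_one s).le
      · have : j = L.length - 2 := min_eq_right hgt.le
        have hc : ((L.length - 2 : ℕ) : ℝ) = (L.length : ℝ) - 2 := by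
          rw [Nat.cast_sub h2]; norm_num
        rw [this, hc]
        linarith
    refine ⟨j, hj, ?_⟩
    rw [affineInterp_eq_lineMap L j hj ⟨hsj, hsj1⟩, segment_eq_image_lineMap]
    exact ⟨s - j, ⟨by linarith, by linarith⟩, rfl⟩

/-! ### Scaling the planar drawing by the mesh -/

/-- Scaling by `δ` maps segments to segments. [folklore] -/
theorem block_segment_mul (δ : ℝ) (a b : ℂ) :
    segment ℝ ((δ : ℂ) * a) ((δ : ℂ) * b) = (fun z : ℂ => (δ : ℂ) * z) '' segment ℝ a b := by
  have h := image_segment ℝ ((LinearMap.mul ℝ ℂ (δ : ℂ)).toAffineMap) a b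
  simp only [LinearMap.coe_toAffineMap, LinearMap.mul_apply'] at h
  exact h.symm

/-- `G_s`-edges have length at most `1` in the drawing `zS`. [cite: Beffara2008Universal, §5.1] -/
theorem block_dist_zS_le_one {u v : MixedSite} (h : gsGraph.Adj u v) : dist (zS u) (zS v) ≤ 1 := by
  have := lower_dist_le (δ := 1) one_pos h
  simpa using this

/-- At mesh `δ > 0` adjacent sites are drawn within `δ`. [cite: Beffara2008Universal, §5.1] -/
theorem block_dist_pos_le {u v : MixedSite} {δ : ℝ} (hδ : 0 < δ) (h : gsGraph.Adj u v) :
    dist ((δ : ℂ) * zS u) ((δ : ℂ) * zS v) ≤ δ :=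
  lower_dist_le hδ h

/-! ### The polyline of a chain: where its points are -/

/-- **Points of the polyline of a chain.**  Let `f : Fin (n+1) → MixedSite` be a chain of `G_s`-adjacent sites drawn at mesh
`δ > 0`, `L = [δ·zS (f 0), …, δ·zS (f n)]`.  Every point `x = affineInterp L s`, `s ∈ [0, n]`, is within `δ` of some vertex
position `δ·zS (f i)`, and either `n = 0` and `x = δ·zS (f 0)`, or `x` lies on the closed segment of two ADJACENT sites of the
chain. [folklore] -/
theorem block_trace_point {n : ℕ} (f : Fin (n + 1) → MixedSite)
    (hadj : ∀ i : Fin n, gsGraph.Adj (f (Fin.castSucc i)) (f (Fin.succ i))) {δ : ℝ} (hδ : 0 < δ)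
    {s : ℝ} (hs0 : 0 ≤ s) (hs1 : s ≤ n) :
    (∃ i : Fin (n + 1), dist (affineInterp (List.ofFn fun i => (δ : ℂ) * zS (f i)) s) ((δ : ℂ) * zS (f i)) ≤ δ) ∧
    ((n = 0 ∧ affineInterp (List.ofFn fun i => (δ : ℂ) * zS (f i)) s = (δ : ℂ) * zS (f 0)) ∨
      ∃ (u v : MixedSite), gsGraph.Adj u v ∧ (∃ i, f i = u) ∧ (∃ i, f i = v) ∧
        affineInterp (List.ofFn fun i => (δ : ℂ) * zS (f i)) s ∈ segment ℝ ((δ : ℂ) * zS u) ((δ : ℂ) * zS v)) := by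
  have hget : ∀ (j : ℕ) (hj : j < (List.ofFn fun i => (δ : ℂ) * zS (f i)).length),
      (List.ofFn fun i => (δ : ℂ) * zS (f i))[j] =
        (δ : ℂ) * zS (f ⟨j, by simpa [List.length_ofFn] using hj⟩) := by
    intro j hj
    simp only [List.getElem_ofFn]
  set L : List ℂ := List.ofFn fun i => (δ : ℂ) * zS (f i) with hLdef
  have hlen : L.length = n + 1 := by rw [hLdef, List.length_ofFn]
  have hL : L ≠ [] := List.ne_nil_of_length_pos (by rw [hlen]; omega)
  have hs1' : s ≤ (L.length : ℝ) - 1 := by rw [hlen]; push_cast; linarith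
  rcases block_affineInterp_mem L hL hs0 hs1' with ⟨h1, hx⟩ | ⟨j, hj, hx⟩
  · have hn : n = 0 := by omega
    have hx' : affineInterp L s = (δ : ℂ) * zS (f 0) := by
      rw [hx, hget 0 (by rw [hlen]; omega)]; rfl
    refine ⟨⟨0, ?_⟩, Or.inl ⟨hn, hx'⟩⟩
    rw [hx', dist_self]; exact hδ.le
  · have hjn : j < n := by rw [hlen] at hj; omega
    set i : Fin n := ⟨j, hjn⟩ with hidef
    have e1 : L[j] = (δ : ℂ) * zS (f (Fin.castSucc i)) := by rw [hget]; rfl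
    have e2 : L[j + 1] = (δ : ℂ) * zS (f (Fin.succ i)) := by rw [hget]; rfl
    rw [e1, e2] at hx
    refine ⟨⟨Fin.castSucc i, ?_⟩, Or.inr ⟨_, _, hadj i, ⟨_, rfl⟩, ⟨_, rfl⟩, hx⟩⟩
    -- a point of the segment `[a, b]` is within `dist a b` of `a` (the closed ball about `a` is convex)
    have hxa : dist (affineInterp L s) ((δ : ℂ) * zS (f (Fin.castSucc i))) ≤
        dist ((δ : ℂ) * zS (f (Fin.castSucc i))) ((δ : ℂ) * zS (f (Fin.succ i))) :=
      mem_closedBall.1 ((convex_closedBall _ _).segment_subset (mem_closedBall_self dist_nonneg)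
        (mem_closedBall.2 (by rw [dist_comm])) hx)
    exact hxa.trans (block_dist_pos_le hδ (hadj i))

/-! ### Disjointness of the polylines of vertex-disjoint chains (planarity) -/

/-- **Polylines of vertex-disjoint chains are disjoint.**  By the planarity of the straight-line drawing of `G_s`
(hypothesis `hP : Sig.stub_gsPlanar`, landed as `stub_gsPlanar`): if two chains of adjacent sites have no site in common (e.g. one consists of open, the other of closed
sites), the polylines through their drawn positions at mesh `δ > 0` do not meet. [cite: Beffara2008Universal, §5.1] -/
theorem block_traces_disjoint (hP : Sig.stub_gsPlanar) {n n' : ℕ} (f : Fin (n + 1) → MixedSite) (f' : Fin (n' + 1) → MixedSite)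
    (hadj : ∀ i : Fin n, gsGraph.Adj (f (Fin.castSucc i)) (f (Fin.succ i)))
    (hadj' : ∀ i : Fin n', gsGraph.Adj (f' (Fin.castSucc i)) (f' (Fin.succ i)))
    (hdis : ∀ i j, f i ≠ f' j) {δ : ℝ} (hδ : 0 < δ)
    {s s' : ℝ} (hs0 : 0 ≤ s) (hs1 : s ≤ n) (hs0' : 0 ≤ s') (hs1' : s' ≤ n') :
    affineInterp (List.ofFn fun i => (δ : ℂ) * zS (f i)) s ≠
      affineInterp (List.ofFn fun i => (δ : ℂ) * zS (f' i)) s' := by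
  obtain ⟨hinj, hvert, hedge⟩ := hP
  have hδ0 : (δ : ℂ) ≠ 0 := Complex.ofReal_ne_zero.2 hδ.ne'
  -- undo the scaling by `δ`
  have unscale_pt : ∀ {a b : MixedSite}, (δ : ℂ) * zS a = (δ : ℂ) * zS b → a = b := fun h =>
    hinj (mul_left_cancel₀ hδ0 h)
  have unscale_mem : ∀ {x : ℂ} {a b : MixedSite}, x ∈ segment ℝ ((δ : ℂ) * zS a) ((δ : ℂ) * zS b) →
      ∃ y ∈ segment ℝ (zS a) (zS b), x = (δ : ℂ) * y := fun {x a b} hx => by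
    rw [block_segment_mul] at hx
    obtain ⟨y, hy, rfl⟩ := hx
    exact ⟨y, hy, rfl⟩
  intro heq
  obtain ⟨-, hcase⟩ := block_trace_point f hadj hδ hs0 hs1
  obtain ⟨-, hcase'⟩ := block_trace_point f' hadj' hδ hs0' hs1'
  rcases hcase with ⟨-, hx⟩ | ⟨u, v, huv, ⟨i, rfl⟩, ⟨i2, rfl⟩, hx⟩ <;>
    rcases hcase' with ⟨-, hx'⟩ | ⟨u', v', hu'v', ⟨j, rfl⟩, ⟨j2, rfl⟩, hx'⟩
  · -- vertex / vertex
    exact hdis 0 0 (unscale_pt (hx.symm.trans (heq.trans hx')))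
  · -- vertex / edge
    rw [hx] at heq
    rw [← heq] at hx'
    obtain ⟨y, hy, hyx⟩ := unscale_mem hx'
    have : y = zS (f 0) := (mul_left_cancel₀ hδ0 hyx).symm
    rw [this] at hy
    exact hvert _ _ _ hu'v' (hdis 0 j) (hdis 0 j2) hy
  · -- edge / vertex
    rw [hx'] at heq
    rw [heq] at hx
    obtain ⟨y, hy, hyx⟩ := unscale_mem hx
    have : y = zS (f' 0) := (mul_left_cancel₀ hδ0 hyx).symm
    rw [this] at hy
    exact hvert _ _ _ huv (fun h => hdis i 0 h.symm) (fun h => hdis i2 0 h.symm) hy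
  · -- edge / edge
    obtain ⟨y, hy, hyx⟩ := unscale_mem hx
    obtain ⟨y', hy', hyx'⟩ := unscale_mem hx'
    have hyy : y = y' := mul_left_cancel₀ hδ0 (hyx.symm.trans (heq.trans hyx'))
    rw [← hyy] at hy'
    exact Set.disjoint_left.1 (hedge _ _ _ _ huv hu'v' (hdis i j) (hdis i j2) (hdis i2 j) (hdis i2 j2)) hy hy'

/-! ### Uniform continuity of a chart on the model box, and coordinates of nearby points -/

/-- **Uniform continuity of a plane homeomorphism on the model box `[-2, 2]²`** (Heine–Cantor), with the modulus clipped to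
`≤ 1`. [folklore] -/
theorem block_uc (Φ : ℂ ≃ₜ ℂ) {ε : ℝ} (hε : 0 < ε) :
    ∃ η : ℝ, 0 < η ∧ η ≤ 1 ∧ ∀ z ∈ Icc (-2 : ℝ) 2 ×ℂ Icc (-2 : ℝ) 2, ∀ z' ∈ Icc (-2 : ℝ) 2 ×ℂ Icc (-2 : ℝ) 2,
      dist z z' < η → dist (Φ z) (Φ z') < ε := by
  have hB : IsCompact (Icc (-2 : ℝ) 2 ×ℂ Icc (-2 : ℝ) 2) := isCompact_Icc.reProdIm isCompact_Icc
  obtain ⟨η, hη, h⟩ := Metric.uniformContinuousOn_iff.1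
    (hB.uniformContinuousOn_of_continuous Φ.continuous.continuousOn) ε hε
  exact ⟨min η 1, lt_min hη one_pos, min_le_right _ _,
    fun z hz z' hz' hd => h z hz z' hz' (hd.trans_le (min_le_left _ _))⟩

/-- Coordinates of a point within `ν` of another. [folklore] -/
theorem block_re_im_of_dist {w z : ℂ} {ν : ℝ} (h : dist w z ≤ ν) :
    z.re - ν ≤ w.re ∧ w.re ≤ z.re + ν ∧ z.im - ν ≤ w.im ∧ w.im ≤ z.im + ν := by
  rw [Complex.dist_eq] at h
  have h1 := (Complex.abs_re_le_norm (w - z)).trans h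
  have h2 := (Complex.abs_im_le_norm (w - z)).trans h
  rw [Complex.sub_re, abs_le] at h1
  rw [Complex.sub_im, abs_le] at h2
  exact ⟨by linarith [h1.1], by linarith [h1.2], by linarith [h2.1], by linarith [h2.2]⟩

/-! ### Registered sub-goal of the blocking stub (closed form) -/

/-- **Registered sub-goal `block_tracesDisjoint_holds`** (closed form of `block_traces_disjoint`, the lattice-side input of
`stub_blocking_of_planar`): given the planarity of the drawing of `G_s`, the polylines of two vertex-disjoint chains of
`G_s`-adjacent sites, drawn at any mesh `δ > 0`, are disjoint. [cite: Beffara2008Universal, §5.1] -/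
theorem block_tracesDisjoint_holds : Summit.CriticalPhenomena.CardyFormulaZ2.Cruxes.CoveringLeg.FiveArmNull.Sig.stub_gsPlanar → ∀ (n n' : ℕ) (f : Fin (n + 1) → Literature.Barriers.CriticalPhenomena.MixedSite) (f' : Fin (n' + 1) → Literature.Barriers.CriticalPhenomena.MixedSite), (∀ i : Fin n, Summit.CriticalPhenomena.CardyFormulaZ2.Cruxes.CoveringLeg.FiveArmNull.gsGraph.Adj (f (Fin.castSucc i)) (f (Fin.succ i))) → (∀ i : Fin n', Summit.CriticalPhenomena.CardyFormulaZ2.Cruxes.CoveringLeg.FiveArmNull.gsGraph.Adj (f' (Fin.castSucc i)) (f' (Fin.succ i))) → (∀ i j, f i ≠ f' j) → ∀ δ : ℝ, 0 < δ → ∀ s s' : ℝ, 0 ≤ s → s ≤ n → 0 ≤ s' → s' ≤ n' → Literature.Probability.RandomPlanarGeometry.affineInterp (List.ofFn fun i => (δ : ℂ) * Summit.CriticalPhenomena.CardyFormulaZ2.Cruxes.CoveringLeg.FiveArmNull.zS (f i)) s ≠ Literature.Probability.RandomPlanarGeometry.affineInterp (List.ofFn fun i => (δ : ℂ) * Summit.CriticalPhenomena.CardyFormulaZ2.Cruxes.CoveringLeg.FiveArmNull.zS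 (f' i)) s' :=
  fun hP _ _ f f' hadj hadj' hdis _ hδ _ _ hs0 hs1 hs0' hs1' =>
    block_traces_disjoint hP f f' hadj hadj' hdis hδ hs0 hs1 hs0' hs1'

end Summit.CriticalPhenomena.CardyFormulaZ2.Cruxes.CoveringLeg.FiveArmNull

end
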